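import Summits.KontsevichZagierPeriods.KontsevichZagierPeriods.Theses.VeryGoodTransfer
import Literature.NumberTheory.Transcendental.KZProductIdeal
import Literature.NumberTheory.Transcendental.KZLogCalculusProofs

/-!
# `NewtonLeibnizAnyCoordinate` (stmt-KontsevichZagierPeriods-5090, route VeryGoodTransfer) — proof

Kontsevich–Zagier's rule (3) of the calculus `KZCalculus.lean` (`KZ.newtonLeibnizRel`) is the
Newton–Leibniz move along the LAST coordinate of `ℝⁿ⁺¹`: a band
`{z | init z ∈ τ, a (init z) ≤ z last ≤ b (init z)}` over a base `τ ⊆ ℝⁿ`, a primitive `F`,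
`ℚ`-semialgebraic on the band, continuous on each closed fibre with derivative the integrand on the
open fibre, and base integrand `F(x, b x) − F(x, a x)`. The item asks for the same move along an
ARBITRARY coordinate `j : Fin (n + 1)`, the band being described by `Fin.removeNth j` /
`Fin.insertNth j`.

Proof: relabel coordinates by a permutation `e` of `Fin (n + 1)` with `e j = last` and
`e (j.succAbove i) = castSucc i` (namely `(finSuccEquiv' j).trans finSuccEquivLast.symm`), so that
`(w ∘ e) j = w last`, `removeNth j (w ∘ e) = init w` and `(snoc x t) ∘ e = insertNth j t x`. Then
`[r] − [r.reindex e]` is a change of variables (`KZ.of_sub_of_reindex_mem_relations`, a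
permutation matrix has `|det| = 1`), and `[r.reindex e] − [r']` is literally one instance of
`KZ.newtonLeibnizRel` with the primitive `F ∘ (· ∘ e)` (semialgebraic by
`IsSemialgebraicFunOn.comp_equiv`), all fibrewise clauses being transported by the identity
`(snoc x t) ∘ e = insertNth j t x`. No new mathematics.
-/

noncomputable section

open Set
open Literature.NumberTheory.Transcendental

namespace Summit.KontsevichZagierPeriods.VeryGoodTransfer

/-- **The permutation moving `j` to the last slot.** There is a permutation `e` of `Fin (n + 1)` with
`e j = last n` and `e (j.succAbove i) = castSucc i`; reading a tuple `w` through it,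
`removeNth j (w ∘ e) = init w`, and reading `snoc x t` through it gives `insertNth j t x`. [folklore] -/
theorem exists_perm_toLast (n : ℕ) (j : Fin (n + 1)) :
    ∃ e : Fin (n + 1) ≃ Fin (n + 1), e j = Fin.last n ∧
      (∀ w : Fin (n + 1) → ℝ, Fin.removeNth j (fun i => w (e i)) = Fin.init w) ∧
      (∀ (x : Fin n → ℝ) (t : ℝ),
        (fun i => (Fin.snoc x t : Fin (n + 1) → ℝ) (e i)) = (Fin.insertNth j t x : Fin (n + 1) → ℝ)) := by
  refine ⟨(finSuccEquiv' j).trans finSuccEquivLast.symm, by simp, fun w => ?_, fun x t => ?_⟩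
  · ext i
    simp [Fin.removeNth_apply, Fin.init]
  · rw [Fin.eq_insertNth_iff]
    refine ⟨by simp, ?_⟩
    ext i
    simp [Fin.removeNth_apply]

/-- **`NewtonLeibnizAnyCoordinate`** (route VeryGoodTransfer, stmt-KontsevichZagierPeriods-5090):
Kontsevich–Zagier's Newton–Leibniz move along an arbitrary coordinate `j` of `ℝⁿ⁺¹` — band in
direction `j` over a `ℚ`-semialgebraic base `r'.domain ⊆ ℝⁿ` between two semialgebraic functions
`a ≤ b`, primitive `F` semialgebraic on the band, continuous on each closed fibre and with derivative
the integrand of `r` on each open fibre, base integrand `F(b) − F(a)` — is a relation: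
`[r] − [r'] ∈ KZ.relations`. Proof: the coordinate permutation moving `j` to the last slot is a
change-of-variables move (`KZ.of_sub_of_reindex_mem_relations`), after which the data are literally
an instance of the last-coordinate move `KZ.newtonLeibnizRel`. [folklore] -/
theorem newtonLeibnizAnyCoordinate_proof :
    Summit.KontsevichZagierPeriods.KontsevichZagierPeriods.Theses.VeryGoodTransfer.NewtonLeibnizAnyCoordinate := by
  intro n j r r' a b F hF ha hb hab hdom hcont hderiv hint
  obtain ⟨e, hej, hrem, hsnoc⟩ := exists_perm_toLast n j
  -- (1) relabelling coordinates is a change-of-variables move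
  have h₁ : KZ.of r - KZ.of (r.reindex e) ∈ KZ.relations := KZ.of_sub_of_reindex_mem_relations r e
  -- (2) the relabelled representation is a band in the last coordinate: one Newton–Leibniz move
  have h₂ : KZ.of (r.reindex e) - KZ.of r' ∈ KZ.relations := by
    refine KZ.newtonLeibnizRel_subset_relations
      ⟨n, r.reindex e, r', a, b, fun w => F (fun i => w (e i)), hF.comp_equiv e, ha, hb, hab,
        ?_, ?_, ?_, ?_, rfl⟩
    · ext w
      simp only [KZ.IntegralRep.reindex_domain, mem_setOf_eq, hdom, hrem, hej]
    · intro x hx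
      simpa only [hsnoc] using hcont x hx
    · intro x hx t ht
      simpa only [KZ.IntegralRep.reindex_integrand, hsnoc] using hderiv x hx t ht
    · intro x hx
      simpa only [hsnoc] using hint x hx
  have h := KZ.relations.add_mem h₁ h₂
  rwa [sub_add_sub_cancel] at h

end Summit.KontsevichZagierPeriods.VeryGoodTransfer
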